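import Summits.HubbardSuperconductivity.HubbardSuperconductivity.Theorems.SoloBlindPlaquetteWeights
import HarnessLib

/-!
# The plaquette Mott floor (Theorem 42, part 5/5)

Solo-blind programme `HubbardSuperconductivity`, generation 55.

**Theorem (`plaquette_mott_floor`).** On the `L × L` torus, `L` even, with `t = 1` and `U ≥ 16`,
every `N`-particle vector satisfies, with `N_h := L² - N`,
`re ⟨ψ, H_U ψ⟩ ≥ -(4 N_h - (2 - √2)·max(0, 4 N_h - L²) + 64 L²/U) ‖ψ‖²`;
the same bound holds for the lowest energy of every sector (`plaquette_mott_floor_minEnergyOn`).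
For hole densities `δ = N_h/L² > 1/4` this improves the Mott floor `-(4 N_h + 64 L²/U)` of
`SoloBlindMottFloor` (Theorem 34′) by `(2 - √2)(4δ - 1) L²`.

*Mechanism.* In the occupation basis the hole-hop part of the hopping term is a SIGN-FREE adjacency
on configurations (`MottFloor.norm_hop_le`), so any positive AM–GM weights `(w, w')` with
`4ww' ≥ 1` per matrix element are admissible (`norm_hop_le_weighted`); Theorem 34′ is the choice
`w = w' = ½` (charge `4` per hole, the hard-core value of Trugman 1990 / the boson comparison of
Becca–Capone–Sorella 2000 with the trivial boson bound).  Here the bonds are grouped into the BLACK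
plaquettes of `SoloBlindPlaquetteGeometry` (every bond in exactly one) and a hole hop inside a black
plaquette `P` is weighted by the hole pattern of its two configurations on `P`: `(½, ½)` if `P`
carries `1` or `3` holes, `(√2/4, √2/2)` on the (diagonal, adjacent) sides if it carries `2`.  The
charge collected by a configuration from `P` is then at most `Λ(h_P) = (0, 2, 2√2, 2, 0)` — the top
eigenvalue of `h_P` hard-core bosons on a four-cycle — instead of `4·(incident hole bonds)`; summing
over black plaquettes with `Σ_P h_P = 2·#holes`, `#P = L²/2` and the concave majorants
`Λ(h) ≤ 2h`, `Λ(h) ≤ (2√2-2)h + (4-2√2)` gives the hole charge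
`min(4E, (4√2-4)E + (2-√2)L²) = 4E - (2-√2)(4E - L²)₊`, `E = N_h + D(s)`; doublon terms are
treated exactly as in Theorem 34′ (`α = U/32`, `β = 8/U`). [this work]
-/

noncomputable section

namespace Summit.HubbardSuperconductivity.HubbardSuperconductivity.Theorems.PlaquetteMottFloor

open Matrix Finset Literature.Probability.LatticeModels Literature.MathematicalPhysics.QuantumLattice
  Literature.MathematicalPhysics.QuantumLattice.EigenvalueContinuation
  Summit.HubbardSuperconductivity.HubbardSuperconductivity.Theorems.MottFloor
open scoped ComplexOrder ComplexConjugate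

variable {L : ℕ} [NeZero L]

/-! ### Grouping the bonds by black plaquettes -/

/-- **Every bond once, by black plaquettes**: for `F ≥ 0`,
`Σ_{x ∼ y} F(x,y) ≤ Σ_{k black} Σ_i F(site k (src i), site k (dst i))`. [this work] -/
theorem sum_adj_le_sum_black (hL : Even L) (F : FermionTorus 2 L → FermionTorus 2 L → ℝ)
    (hF : ∀ x y, 0 ≤ F x y) :
    ∑ x, ∑ y, (if (fermionTorusGraph 2 L).Adj x y then F x y else 0) ≤
      ∑ k ∈ blackSet L, ∑ i : Fin 4 × Bool, F (site k (src i)) (site k (dst i)) := by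
  classical
  set A : Finset (FermionTorus 2 L × FermionTorus 2 L) :=
    (univ ×ˢ univ).filter fun p => (fermionTorusGraph 2 L).Adj p.1 p.2 with hA
  set G : TorusSite 2 L × (Fin 4 × Bool) → ℝ := fun q => F (site q.1 (src q.2)) (site q.1 (dst q.2))
    with hG
  have hLHS : ∑ x, ∑ y, (if (fermionTorusGraph 2 L).Adj x y then F x y else 0) =
      ∑ p ∈ A, F p.1 p.2 := by
    rw [hA, Finset.sum_filter, ← Finset.sum_product' (f := fun x y =>
      if (fermionTorusGraph 2 L).Adj x y then F x y else 0)]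
  -- the chosen black plaquette of an adjacent pair
  have hex : ∀ p ∈ A, ∃ q : TorusSite 2 L × (Fin 4 × Bool),
      IsBlack q.1 ∧ site q.1 (src q.2) = p.1 ∧ site q.1 (dst q.2) = p.2 := by
    intro p hp
    rw [hA, Finset.mem_filter] at hp
    obtain ⟨q, hq, h1, h2⟩ := exists_black hL ((fermionTorusGraph_adj _ _).1 hp.2)
    refine ⟨q, hq, ?_, ?_⟩
    · rw [site, h1, FermionTorus.ofTorusSite_toTorusSite]
    · rw [site, h2, FermionTorus.ofTorusSite_toTorusSite]
  choose! m hm using hex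
  have hinj : Set.InjOn m A := by
    intro p hp p' hp' h
    have e1 := (hm p hp).2.1
    have e2 := (hm p hp).2.2
    have e1' := (hm p' hp').2.1
    have e2' := (hm p' hp').2.2
    rw [h] at e1 e2
    exact Prod.ext (e1.symm.trans e1') (e2.symm.trans e2')
  have hstep : ∑ p ∈ A, F p.1 p.2 = ∑ q ∈ A.image m, G q := by
    rw [Finset.sum_image hinj]
    refine Finset.sum_congr rfl fun p hp => ?_
    simp only [hG, (hm p hp).2.1, (hm p hp).2.2]
  have hsub : A.image m ⊆ blackSet L ×ˢ (univ : Finset (Fin 4 × Bool)) := by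
    intro q hq
    rw [Finset.mem_image] at hq
    obtain ⟨p, hp, rfl⟩ := hq
    exact Finset.mem_product.2 ⟨mem_blackSet.2 (hm p hp).1, Finset.mem_univ _⟩
  rw [hLHS, hstep, ← Finset.sum_product (f := G)]
  exact Finset.sum_le_sum_of_subset_of_nonneg hsub fun q _ _ => hF _ _

/-- Corner sums of an indicator against the black plaquettes count every site twice. [this work] -/
theorem sum_black_site_indicator (hL : Even L) (P : FermionTorus 2 L → Prop) [DecidablePred P] :
    ∑ k ∈ blackSet L, ∑ c : Fin 4, (if P (site k c) then (1 : ℝ) else 0) =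
      2 * ((univ.filter P).card : ℝ) := by
  have h := sum_black_corner hL (fun z => if P (FermionTorus.ofTorusSite z) then (1 : ℝ) else 0)
  have e : ∑ z : TorusSite 2 L, (if P (FermionTorus.ofTorusSite z) then (1 : ℝ) else 0) =
      ∑ x : FermionTorus 2 L, (if P x then (1 : ℝ) else 0) :=
    Equiv.sum_comp FermionTorus.equivTorusSite.symm (fun x => if P x then (1 : ℝ) else 0)
  calc ∑ k ∈ blackSet L, ∑ c : Fin 4, (if P (site k c) then (1 : ℝ) else 0)
      = ∑ k ∈ blackSet L, ∑ c : Fin 4,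
          (if P (FermionTorus.ofTorusSite (k + off c)) then (1 : ℝ) else 0) := rfl
    _ = 2 * ∑ z : TorusSite 2 L, (if P (FermionTorus.ofTorusSite z) then (1 : ℝ) else 0) := h
    _ = 2 * ((univ.filter P).card : ℝ) := by
        rw [e, ← Finset.sum_filter, Finset.sum_const, nsmul_eq_mul, mul_one]

/-- `Σ_{k black} cnt(pattern) = 2·#holes`. [this work] -/
theorem sum_black_cnt (hL : Even L) (s : Finset (Orb (FermionTorus 2 L))) :
    ∑ k ∈ blackSet L, (cnt (pat k s) : ℝ) = 2 * (holeCount s : ℝ) := by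
  have h := sum_black_site_indicator hL (IsEmp s)
  rw [holeCount, ← h]
  refine Finset.sum_congr rfl fun k _ => ?_
  rw [← sum_ite_cnt]
  refine Finset.sum_congr rfl fun c _ => ?_
  simp only [pat, decide_eq_true_eq]

/-- **First majorant**: `holeCharge s ≤ 4·#holes`. [this work] -/
theorem holeCharge_le_four (hL : Even L) (s : Finset (Orb (FermionTorus 2 L))) :
    holeCharge s ≤ 4 * (holeCount s : ℝ) := by
  have h := sum_black_cnt hL s
  calc holeCharge s ≤ ∑ k ∈ blackSet L, 2 * (cnt (pat k s) : ℝ) :=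
        Finset.sum_le_sum fun k _ => wt_mul_mixed_le_two_mul _
    _ = 4 * (holeCount s : ℝ) := by rw [← Finset.mul_sum, h]; ring

/-- **Second majorant**: `holeCharge s ≤ (4√2 - 4)·#holes + (2 - √2) L²`. [this work] -/
theorem holeCharge_le_line (hL : Even L) (s : Finset (Orb (FermionTorus 2 L))) :
    holeCharge s ≤ (4 * Real.sqrt 2 - 4) * (holeCount s : ℝ) + (2 - Real.sqrt 2) * (L : ℝ) ^ 2 := by
  have h := sum_black_cnt hL s
  have hc := card_blackSet hL
  calc holeCharge s
      ≤ ∑ k ∈ blackSet L, ((2 * Real.sqrt 2 - 2) * (cnt (pat k s) : ℝ) + (4 - 2 * Real.sqrt 2)) :=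
        Finset.sum_le_sum fun k _ => wt_mul_mixed_le_line _
    _ = (4 * Real.sqrt 2 - 4) * (holeCount s : ℝ) + (2 - Real.sqrt 2) * (L : ℝ) ^ 2 := by
        rw [Finset.sum_add_distrib, ← Finset.mul_sum, h, Finset.sum_const, nsmul_eq_mul, hc]
        ring

/-! ### The hopping energy against the plaquette charges -/

/-- A positive even side exceeds `1`. [folklore] -/
private theorem one_lt_of_even (hL : Even L) : 1 < L := by
  have h0 : L ≠ 0 := NeZero.ne L
  obtain ⟨r, hr⟩ := hL
  omega

/-- **The hopping energy against holes, doublons and plaquettes**: for `α > 0`, `4αβ = 1`, `L` even,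
`re ⟨ψ, Σ_{x∼y,σ} c†_{xσ} c_{yσ} ψ⟩ ≤ Σ_s |ψ(s)|² (holeCharge s + (4 + 16α) D(s) + 8β L²)`.
[this work] -/
theorem re_hopping_le_plaquette (hL : Even L) {α β : ℝ} (hα : 0 < α) (hαβ : 4 * α * β = 1)
    (ψ : Fock (Orb (FermionTorus 2 L))) :
    (star ψ ⬝ᵥ (∑ x : FermionTorus 2 L, ∑ y, ∑ σ : Fin 2,
        if (fermionTorusGraph 2 L).Adj x y then creation (orb x σ) * annihilation (orb y σ) else 0)
        *ᵥ ψ).re ≤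
      ∑ s, ‖ψ s‖ ^ 2 * (holeCharge s + (4 + 16 * α) * (doublonCount s : ℝ) +
        8 * β * (L : ℝ) ^ 2) := by
  have h1L := one_lt_of_even (L := L) hL
  have hβ : 0 ≤ β := by
    have : 0 < 4 * α * β := by rw [hαβ]; exact one_pos
    nlinarith
  -- expand the expectation bond by bond
  have hexp : (star ψ ⬝ᵥ (∑ x : FermionTorus 2 L, ∑ y, ∑ σ : Fin 2,
        if (fermionTorusGraph 2 L).Adj x y then creation (orb x σ) * annihilation (orb y σ) else 0)
        *ᵥ ψ).re =
      ∑ x : FermionTorus 2 L, ∑ y, ∑ σ : Fin 2,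
        (if (fermionTorusGraph 2 L).Adj x y then
          star ψ ⬝ᵥ ((creation (orb x σ) * annihilation (orb y σ)) *ᵥ ψ) else 0).re := by
    simp only [Matrix.sum_mulVec, dotProduct_sum, Complex.re_sum, dotProduct_ite_mulVec]
  rw [hexp]
  -- the nonnegative bond function
  set F : FermionTorus 2 L → FermionTorus 2 L → ℝ := fun x y =>
    ∑ σ : Fin 2, ‖star ψ ⬝ᵥ ((creation (orb x σ) * annihilation (orb y σ)) *ᵥ ψ)‖ with hF
  have hF0 : ∀ x y, 0 ≤ F x y := fun x y => Finset.sum_nonneg fun σ _ => norm_nonneg _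
  have hle1 : ∑ x : FermionTorus 2 L, ∑ y, ∑ σ : Fin 2,
        (if (fermionTorusGraph 2 L).Adj x y then
          star ψ ⬝ᵥ ((creation (orb x σ) * annihilation (orb y σ)) *ᵥ ψ) else 0).re ≤
      ∑ x : FermionTorus 2 L, ∑ y, (if (fermionTorusGraph 2 L).Adj x y then F x y else 0) := by
    refine Finset.sum_le_sum fun x _ => Finset.sum_le_sum fun y _ => ?_
    split_ifs with h
    · exact Finset.sum_le_sum fun σ _ => Complex.re_le_norm _
    · simp
  refine hle1.trans ((sum_adj_le_sum_black hL F hF0).trans ?_)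
  -- bound each plaquette bond term
  have hbond : ∀ (k : TorusSite 2 L) (i : Fin 4 × Bool),
      F (site k (src i)) (site k (dst i)) ≤
        ∑ σ : Fin 2, ∑ s, ‖ψ s‖ ^ 2 * W α β (pw k) s (site k (src i)) (site k (dst i)) σ := by
    intro k i
    refine Finset.sum_le_sum fun σ _ => ?_
    exact norm_bond_le_w hα hαβ (pw k) ψ (site_ne h1L k (src_ne_dst i)) σ
      (fun u h1 h2 h3 h4 => pw_admissible h1L k i σ u h1 h2 h3 h4)
  calc ∑ k ∈ blackSet L, ∑ i : Fin 4 × Bool, F (site k (src i)) (site k (dst i))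
      ≤ ∑ k ∈ blackSet L, ∑ i : Fin 4 × Bool, ∑ σ : Fin 2, ∑ s,
          ‖ψ s‖ ^ 2 * W α β (pw k) s (site k (src i)) (site k (dst i)) σ :=
        Finset.sum_le_sum fun k _ => Finset.sum_le_sum fun i _ => hbond k i
    _ = ∑ s, ‖ψ s‖ ^ 2 * ∑ k ∈ blackSet L, ∑ i : Fin 4 × Bool, ∑ σ : Fin 2,
          W α β (pw k) s (site k (src i)) (site k (dst i)) σ := by
        have e1 : ∀ (k : TorusSite 2 L) (i : Fin 4 × Bool),
            ∑ σ : Fin 2, ∑ s, ‖ψ s‖ ^ 2 * W α β (pw k) s (site k (src i)) (site k (dst i)) σ =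
              ∑ s, ∑ σ : Fin 2, ‖ψ s‖ ^ 2 * W α β (pw k) s (site k (src i)) (site k (dst i)) σ :=
          fun k i => Finset.sum_comm
        have e2 : ∀ k : TorusSite 2 L,
            ∑ i : Fin 4 × Bool, ∑ s, ∑ σ : Fin 2,
                ‖ψ s‖ ^ 2 * W α β (pw k) s (site k (src i)) (site k (dst i)) σ =
              ∑ s, ∑ i : Fin 4 × Bool, ∑ σ : Fin 2,
                ‖ψ s‖ ^ 2 * W α β (pw k) s (site k (src i)) (site k (dst i)) σ :=
          fun k => Finset.sum_comm
        simp_rw [e1, e2]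
        rw [Finset.sum_comm]
        refine Finset.sum_congr rfl fun s _ => ?_
        rw [Finset.mul_sum]
        refine Finset.sum_congr rfl fun k _ => ?_
        rw [Finset.mul_sum]
        refine Finset.sum_congr rfl fun i _ => ?_
        rw [Finset.mul_sum]
    _ ≤ ∑ s, ‖ψ s‖ ^ 2 * (holeCharge s + (4 + 16 * α) * (doublonCount s : ℝ) +
          8 * β * (L : ℝ) ^ 2) := by
        refine Finset.sum_le_sum fun s _ => mul_le_mul_of_nonneg_left ?_ (by positivity)
        have hk : ∀ k : TorusSite 2 L,
            ∑ i : Fin 4 × Bool, ∑ σ : Fin 2, W α β (pw k) s (site k (src i)) (site k (dst i)) σ ≤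
              (2 + 8 * α) * ∑ c : Fin 4, (if IsDbl s (site k c) then (1 : ℝ) else 0) + 16 * β +
                wt (pat k s) * (mixed (pat k s) : ℝ) :=
          fun k => sum_local_W_le hα.le hβ k s
        refine (Finset.sum_le_sum fun k _ => hk k).trans (le_of_eq ?_)
        rw [Finset.sum_add_distrib, Finset.sum_add_distrib, ← Finset.mul_sum,
          sum_black_site_indicator hL (IsDbl s), ← doublonCount_eq_card_isDbl, Finset.sum_const,
          nsmul_eq_mul, card_blackSet hL, holeCharge]
        ring

/-! ### The plaquette Mott floor -/

/-- **The plaquette Mott floor** (Theorem 42). For `U ≥ 16` (`t = 1`), `L` even and every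
`N`-particle vector `ψ` on the `L × L` torus, with `N_h = L² - N`,
`re ⟨ψ, H_U ψ⟩ ≥ -(4 N_h - (2 - √2)·max(0, 4 N_h - L²) + 64 L²/U) ‖ψ‖²`.
For `N_h ≤ L²/4` this is the Mott floor of Theorem 34′; for `N_h > L²/4` the hole charge per site
drops from `4δ` to `4δ - (2 - √2)(4δ - 1)`. [this work] -/
theorem plaquette_mott_floor (hL : Even L) {U : ℝ} (hU : 16 ≤ U) {N : ℕ}
    {ψ : Fock (Orb (FermionTorus 2 L))} (hψ : IsNParticle N ψ) :
    -(4 * ((L : ℝ) ^ 2 - N) - (2 - Real.sqrt 2) * max 0 (4 * ((L : ℝ) ^ 2 - N) - (L : ℝ) ^ 2) +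
        64 * (L : ℝ) ^ 2 / U) * (star ψ ⬝ᵥ ψ).re ≤
      (star ψ ⬝ᵥ hubbardTorus 2 L 1 U *ᵥ ψ).re := by
  have hU0 : 0 < U := by linarith
  set α : ℝ := U / 32 with hαdef
  set β : ℝ := 8 / U with hβdef
  have hα : 0 < α := by positivity
  have hαβ : 4 * α * β = 1 := by rw [hαdef, hβdef]; field_simp; ring
  set Nh : ℝ := (L : ℝ) ^ 2 - N with hNh
  set B : ℝ := 4 * Nh - (2 - Real.sqrt 2) * max 0 (4 * Nh - (L : ℝ) ^ 2) with hB
  have hs2 : Real.sqrt 2 ≤ 2 := by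
    rw [show (2 : ℝ) = Real.sqrt 4 by
      rw [show (4 : ℝ) = 2 ^ 2 by norm_num, Real.sqrt_sq (by norm_num : (0 : ℝ) ≤ 2)]]
    exact Real.sqrt_le_sqrt (by norm_num)
  have hs0 : 0 ≤ Real.sqrt 2 := Real.sqrt_nonneg 2
  -- split the Hamiltonian
  have hsplit : (star ψ ⬝ᵥ hubbardTorus 2 L 1 U *ᵥ ψ).re =
      -(star ψ ⬝ᵥ (∑ x : FermionTorus 2 L, ∑ y, ∑ σ : Fin 2,
          if (fermionTorusGraph 2 L).Adj x y then creation (orb x σ) * annihilation (orb y σ)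
          else 0) *ᵥ ψ).re +
        U * (star ψ ⬝ᵥ (∑ x : FermionTorus 2 L, numberOp x 0 * numberOp x 1) *ᵥ ψ).re := by
    simp only [hubbardTorus, hamiltonian, Complex.ofReal_one, neg_smul, one_smul, Matrix.add_mulVec,
      Matrix.neg_mulVec, Matrix.smul_mulVec, dotProduct_add, dotProduct_neg, dotProduct_smul,
      Complex.add_re, Complex.neg_re, smul_eq_mul, Complex.re_ofReal_mul]
  rw [hsplit, re_expect_doublon, re_star_dotProduct_self_eq]
  have hhop := re_hopping_le_plaquette hL hα hαβ ψ
  -- the hole charge on the support of `ψ`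
  have hterm : ∀ s : Finset (Orb (FermionTorus 2 L)),
      ‖ψ s‖ ^ 2 * (holeCharge s + (4 + 16 * α) * (doublonCount s : ℝ) + 8 * β * (L : ℝ) ^ 2) ≤
        (B + 8 * β * (L : ℝ) ^ 2) * ‖ψ s‖ ^ 2 +
          (8 + 16 * α) * ((doublonCount s : ℝ) * ‖ψ s‖ ^ 2) := by
    intro s
    by_cases hs : s.card = N
    · have hE : (holeCount s : ℝ) = Nh + doublonCount s := by
        have h := holeCount_add_card s
        rw [hs] at h
        have h' : (holeCount s : ℝ) + N = (L : ℝ) ^ 2 + doublonCount s := by exact_mod_cast h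
        rw [hNh]; linarith
      have hD0 : (0 : ℝ) ≤ doublonCount s := by positivity
      have hc : holeCharge s ≤ B + 4 * (doublonCount s : ℝ) := by
        rcases le_total 0 (4 * Nh - (L : ℝ) ^ 2) with hpos | hneg
        · have h2 := holeCharge_le_line hL s
          rw [hE] at h2
          rw [hB, max_eq_right hpos]
          nlinarith [mul_nonneg (sub_nonneg.2 hs2) hD0, mul_nonneg hs0 hD0]
        · have h1 := holeCharge_le_four hL s
          rw [hE] at h1
          rw [hB, max_eq_left hneg]
          linarith
      have hw : 0 ≤ ‖ψ s‖ ^ 2 := by positivity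
      nlinarith [mul_le_mul_of_nonneg_left hc hw]
    · rw [hψ s hs]; simp
  have hsum := (hhop.trans (Finset.sum_le_sum fun s _ => hterm s))
  rw [Finset.sum_add_distrib, ← Finset.mul_sum, ← Finset.mul_sum] at hsum
  have h16 : 16 * α = U / 2 := by rw [hαdef]; ring
  have h8 : 8 * β * (L : ℝ) ^ 2 = 64 * (L : ℝ) ^ 2 / U := by rw [hβdef]; ring
  have hD0 : 0 ≤ ∑ s, (doublonCount s : ℝ) * ‖ψ s‖ ^ 2 :=
    Finset.sum_nonneg fun s _ => by positivity
  have hw0 : 0 ≤ ∑ s, ‖ψ s‖ ^ 2 := Finset.sum_nonneg fun s _ => by positivity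
  rw [h16, h8] at hsum
  nlinarith [hsum, hD0, hw0, mul_nonneg (by linarith : (0 : ℝ) ≤ U / 2 - 8) hD0]

/-- **The plaquette Mott floor of a sector**: for `U ≥ 16`, `L` even and a non-trivial sector
`(N, S_z = M)`, `-(4 N_h - (2 - √2)·max(0, 4 N_h - L²) + 64 L²/U) ≤ minEnergyOn H_U (N, M)`,
`N_h = L² - N`. [this work] -/
theorem plaquette_mott_floor_minEnergyOn (hL : Even L) {U : ℝ} (hU : 16 ≤ U) {N : ℕ} {M : ℝ}
    (hK : szSector (Λ := FermionTorus 2 L) N M ≠ ⊥) :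
    -(4 * ((L : ℝ) ^ 2 - N) - (2 - Real.sqrt 2) * max 0 (4 * ((L : ℝ) ^ 2 - N) - (L : ℝ) ^ 2) +
        64 * (L : ℝ) ^ 2 / U) ≤
      (hubbardTorus 2 L 1 U).minEnergyOn (szSector (Λ := FermionTorus 2 L) N M) := by
  obtain ⟨φ, hφK, hφ1, hφE⟩ := exists_unit_eigen_minEnergyOn (isHermitian_hubbardTorus L 1 U) _
    (fun v hv =>
      _root_.Literature.MathematicalPhysics.QuantumLattice.hubbardTorus_mulVec_mem_szSector 1 U hv)
    hK
  rw [← _root_.Literature.MathematicalPhysics.QuantumLattice.re_rayleigh_of_eigen_minEnergyOn _ _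
    hφ1 hφE]
  have h := plaquette_mott_floor (L := L) hL hU ((mem_szSector_iff N M φ).1 hφK).1
  have h1 : (star φ ⬝ᵥ φ).re = 1 := by rw [hφ1]; simp
  rw [h1, mul_one] at h
  exact h

end Summit.HubbardSuperconductivity.HubbardSuperconductivity.Theorems.PlaquetteMottFloor
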